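import Mathlib
import Literature.Analysis.UnboundedOperators.ConjugateOperatorRegularity
import Literature.Analysis.UnboundedOperators.UnitaryRepSpectralMeasure
import Literature.Analysis.UnboundedOperators.FourierSpectrumCalculus
import HarnessLib
import Summits.AtomisticToContinuum.FouriersLaw.Theorems.EmbeddedDrudeMourreMourreDissolutionLAPSymbolCalculus
import Summits.AtomisticToContinuum.FouriersLaw.Theorems.EmbeddedDrudeMourreMourreDissolutionLAPExpUnitary

/-!
# Stub `stub_mourreThresholdLAP` — Mourre LAP infrastructure 15: symbols of the smeared group algebra II (exponentials, resolvents)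

Item `stmt-AtomisticToContinuum-12594` (crux `MourreDissolution` of route `EmbeddedDrudeMourre`,
sub-problem `FouriersLaw`), line `separable-vertex-faddeev-pair-sector`, stub S6
`stub_mourreThresholdLAP` (Mourre's limiting absorption principle; NOT in the tree). Fourth step of
L3 of the proof map (route (b)), over `…LAPSymbolCalculus` (symbol data `d = (c, k)` with operator
`d.op U = c·1 + U[k]`, symbol `d.fn = c + ǩ`, `⟪v, d.op v⟫ = ∫ d.fn dμ_v`) and `…LAPExpUnitary`
(`expI B τ = e^{iτB}`):

* §1 exponentials: `⟪v, exp(d.op) v⟫ = ∫ exp(d.fn) dμ_v` (exponential series on both sides; the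
  operator side through `S ↦ ⟪v, S v⟫`, the symbol side by dominated convergence) and
  `⟪v, e^{iτ d.op} v⟫ = ∫ e^{iτ d.fn(ξ)} dμ_v(ξ)` (headline `inner_expUnitary_eq_integral_symbol`);
* §2 the resolvent data: `R(z) = U[k_z]` with symbol `ǩ_z(ξ) = (ξ - z)⁻¹` for every non-real `z`
  (Laplace integral for `Im z < 0`; `(k̄(-·))ˇ = conj ǩ` for the upper half-plane).
-/

noncomputable section

open MeasureTheory Complex Filter Topology Set
open scoped InnerProductSpace ComplexConjugate SchwartzMap FourierTransform ENNReal NNReal Nat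

namespace Summit.AtomisticToContinuum.FouriersLaw.Theorems.MourreDissolution

open Literature.Analysis.UnboundedOperators
open Literature.Analysis.UnboundedOperators.UnitaryRep

variable {H : Type*} [NormedAddCommGroup H] [InnerProductSpace ℂ H] [CompleteSpace H]

namespace SymbolDatum

/-! ## §1. Exponentials: `⟪v, e^{B} v⟫ = ∫ e^{b} dμ_v` -/

omit [CompleteSpace H] in
/-- `S ↦ ⟪v, S v⟫` passes to sums of operator series. [folklore] -/
theorem hasSum_inner_apply {S : ℕ → H →L[ℂ] H} {T : H →L[ℂ] H} (h : HasSum S T) (v : H) :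
    HasSum (fun n => ⟪v, S n v⟫_ℂ) ⟪v, T v⟫_ℂ := by
  have h1 := h.mapL (ContinuousLinearMap.apply ℂ H v)
  simp only [ContinuousLinearMap.apply_apply] at h1
  simpa only [innerSL_apply_apply] using h1.mapL (innerSL ℂ v)

/-- **The exponential of a symbol datum**: `⟪v, exp(d.op) v⟫ = ∫ exp(d.fn ξ) dμ_v(ξ)` (exponential
series on the operator side, mapped through `S ↦ ⟪v, S v⟫` and `op_pow`/`inner_op_eq`; exponential
series on the symbol side, integrated term-wise by dominated convergence with the summable constant
bound `Mⁿ/n!`). [folklore] -/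
theorem inner_exp_op_eq (d : SymbolDatum) (U : OneParameterUnitaryGroup H) (v : H) :
    ⟪v, NormedSpace.exp (d.op U) v⟫_ℂ = ∫ ξ, cexp (d.fn ξ) ∂(specMeasure U v) := by
  set μ := specMeasure U v with hμ
  -- operator side
  have h1 : HasSum (fun n : ℕ => ((n.factorial : ℂ))⁻¹ * ∫ ξ, d.fn ξ ^ n ∂μ)
      ⟪v, NormedSpace.exp (d.op U) v⟫_ℂ := by
    have h := hasSum_inner_apply (NormedSpace.exp_series_hasSum_exp' (𝕂 := ℂ) (d.op U)) v
    refine h.congr_fun fun n => ?_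
    show ((n.factorial : ℂ))⁻¹ * ∫ ξ, d.fn ξ ^ n ∂μ = ⟪v, (((n.factorial : ℂ))⁻¹ • d.op U ^ n) v⟫_ℂ
    rw [FunLike.coe_smul, Pi.smul_apply, inner_smul_right, ← op_pow, inner_op_eq]
    congr 1
    exact integral_congr_ae (ae_of_all _ fun ξ => (fn_pow d ξ n).symm)
  -- symbol side
  obtain ⟨M, hM0, hM⟩ : ∃ M : ℝ, 0 ≤ M ∧ ∀ ξ, ‖d.fn ξ‖ ≤ M :=
    ⟨‖d.c‖ + ∫ a, ‖d.k a‖, by positivity, d.norm_fn_le⟩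
  have h2 : HasSum (fun n : ℕ => ∫ ξ, ((n.factorial : ℂ))⁻¹ • d.fn ξ ^ n ∂μ)
      (∫ ξ, cexp (d.fn ξ) ∂μ) := by
    refine hasSum_integral_of_dominated_convergence (fun n _ => M ^ n / n.factorial)
      (fun n => ?_) (fun n => ae_of_all _ fun ξ => ?_) (ae_of_all _ fun ξ => ?_)
      (integrable_const _) (ae_of_all _ fun ξ => ?_)
    · exact ((d.continuous_fn.pow n).const_smul (((n.factorial : ℂ))⁻¹)).aestronglyMeasurable
    · rw [norm_smul, norm_inv, Complex.norm_natCast, norm_pow, div_eq_inv_mul]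
      gcongr
      exact hM ξ
    · exact Real.summable_pow_div_factorial M
    · have := NormedSpace.exp_series_hasSum_exp' (𝕂 := ℂ) (d.fn ξ)
      rwa [← Complex.exp_eq_exp_ℂ] at this
  have h2' : HasSum (fun n : ℕ => ((n.factorial : ℂ))⁻¹ * ∫ ξ, d.fn ξ ^ n ∂μ)
      (∫ ξ, cexp (d.fn ξ) ∂μ) := by
    refine h2.congr_fun fun n => ?_
    show ((n.factorial : ℂ))⁻¹ * ∫ ξ, d.fn ξ ^ n ∂μ = ∫ ξ, ((n.factorial : ℂ))⁻¹ • d.fn ξ ^ n ∂μ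
    rw [integral_smul, smul_eq_mul]
  exact h1.unique h2'

/-- **The unitary group of a symbol datum on the spectral side**:
`⟪v, e^{iτ d.op} v⟫ = ∫ e^{iτ d.fn(ξ)} dμ_v(ξ)`. [folklore] -/
theorem inner_expI_op_eq (d : SymbolDatum) (U : OneParameterUnitaryGroup H) (τ : ℝ) (v : H) :
    ⟪v, expI (d.op U) τ v⟫_ℂ = ∫ ξ, cexp ((τ : ℂ) * I * d.fn ξ) ∂(specMeasure U v) := by
  have e : expI (d.op U) τ = NormedSpace.exp ((smul ((τ : ℂ) * I) d).op U) := by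
    rw [expI, op_smul, ← Complex.coe_smul, smul_smul]
  rw [e, inner_exp_op_eq]
  refine integral_congr_ae (ae_of_all _ fun ξ => ?_)
  simp only [fn_smul]

end SymbolDatum

/-! ## §2. The resolvents as symbol data -/

/-- `(k̄(-·))ˇ(ξ) = conj ǩ(ξ)` (reflection and conjugation of the kernel). [folklore] -/
theorem kernelSymbol_conj_neg (k : ℝ → ℂ) (ξ : ℝ) :
    kernelSymbol (fun t => conj (k (-t))) ξ = conj (kernelSymbol k ξ) := by
  unfold kernelSymbol
  rw [← integral_conj, ← integral_neg_eq_self]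
  refine integral_congr_ae (ae_of_all _ fun t => ?_)
  simp only [map_mul, ← Complex.exp_conj, Complex.conj_ofReal, Complex.conj_I]
  congr 2
  · simp
  · push_cast
    ring

/-- **The Laplace integral of the resolvent kernel**: `ǩ_z(ξ) = ∫ k_z(t) e^{iξt} dt = (ξ - z)⁻¹` for
`Im z < 0` (`-i ∫₀^∞ e^{i(ξ - z)t} dt`). [folklore] -/
theorem kernelSymbol_resolventKernelAt_of_neg {z : ℂ} (hz : z.im < 0) (ξ : ℝ) :
    kernelSymbol (resolventKernelAt z) ξ = 1 / ((ξ : ℂ) - z) := by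
  set a : ℂ := I * ((ξ : ℂ) - z) with ha
  have hare : a.re < 0 := by simp [ha, hz]
  have hane : a ≠ 0 := fun h => by rw [h] at hare; simp at hare
  unfold kernelSymbol
  rw [resolventKernelAt_eq_indicator hz]
  have e1 : (fun t : ℝ => (Set.Ici (0 : ℝ)).indicator (negIExpAt z) t * cexp (((ξ * t : ℝ) : ℂ) * I)) =
      (Set.Ici (0 : ℝ)).indicator fun t : ℝ => -I * cexp (a * t) := by
    funext t
    by_cases ht : t ∈ Set.Ici (0 : ℝ)
    · rw [Set.indicator_of_mem ht, Set.indicator_of_mem ht, negIExpAt, mul_assoc, ← Complex.exp_add]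
      congr 2
      push_cast
      ring
    · rw [Set.indicator_of_notMem ht, Set.indicator_of_notMem ht, zero_mul]
  rw [e1, integral_indicator measurableSet_Ici, integral_Ici_eq_integral_Ioi, integral_const_mul,
    integral_exp_mul_complex_Ioi hare 0]
  simp only [Complex.ofReal_zero, mul_zero, Complex.exp_zero]
  rw [ha]
  field_simp

/-- `ǩ_z(ξ) = (ξ - z)⁻¹` for every non-real `z` (the upper half-plane by `k_{z}(t) = conj k_{z̄}(-t)`).
[folklore] -/
theorem kernelSymbol_resolventKernelAt {z : ℂ} (hz : z.im ≠ 0) (ξ : ℝ) :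
    kernelSymbol (resolventKernelAt z) ξ = 1 / ((ξ : ℂ) - z) := by
  rcases lt_or_gt_of_ne hz with h | h
  · exact kernelSymbol_resolventKernelAt_of_neg h ξ
  · have hz' : (conj z).im < 0 := by rw [Complex.conj_im]; linarith
    have hzc : (conj z).im ≠ 0 := hz'.ne
    have e : resolventKernelAt z = fun t => conj (resolventKernelAt (conj z) (-t)) := by
      funext t
      have := resolventKernelAt_conj hzc t
      rw [Complex.conj_conj] at this
      exact this
    rw [e, kernelSymbol_conj_neg, kernelSymbol_resolventKernelAt_of_neg hz', map_div₀, map_one,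
      map_sub, Complex.conj_ofReal, Complex.conj_conj]

/-- **The resolvent datum**: `(0, k_z)`, whose operator is `R(z)` and whose symbol is `(ξ - z)⁻¹`.
[folklore] -/
def resolventDatum {z : ℂ} (hz : z.im ≠ 0) : SymbolDatum :=
  ⟨0, resolventKernelAt z, integrable_resolventKernelAt_of_ne hz⟩

/-- `(resolventDatum hz).op U = R(z)`. [folklore] -/
theorem resolventDatum_op {z : ℂ} (hz : z.im ≠ 0) (U : OneParameterUnitaryGroup H) :
    (resolventDatum hz).op U = resolventAt U z := by
  rw [SymbolDatum.op, resolventDatum, zero_smul, zero_add, resolventAt]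

/-- `(resolventDatum hz).fn ξ = (ξ - z)⁻¹`. [folklore] -/
theorem resolventDatum_fn {z : ℂ} (hz : z.im ≠ 0) (ξ : ℝ) :
    (resolventDatum hz).fn ξ = 1 / ((ξ : ℂ) - z) := by
  rw [SymbolDatum.fn, resolventDatum, zero_add]
  exact kernelSymbol_resolventKernelAt hz ξ

/-! ## §3. Headline (registered helper stub) -/

/-- **Spectral side of the unitary group generated by an element of the smeared group algebra,
headline form** (all binders explicit; registered helper stub of `stub_mourreThresholdLAP`): for
`B = c·1 + U[k]` with `k` integrable and every real `τ`,
`⟪v, e^{iτB} v⟫ = ∫ exp(iτ (c + ǩ(ξ))) dμ_v(ξ)` with `ǩ(ξ) = ∫ k(a) e^{iξa} da` and `μ_v` the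
Stone–Bochner measure of `v`. [folklore] -/
theorem inner_expUnitary_eq_integral_symbol :
    ∀ (K : Type) [NormedAddCommGroup K] [InnerProductSpace ℂ K] [CompleteSpace K]
      (U : Literature.Analysis.UnboundedOperators.OneParameterUnitaryGroup K) (c : ℂ) (k : ℝ → ℂ)
      (hk : MeasureTheory.Integrable k MeasureTheory.volume) (τ : ℝ) (v : K),
      @inner ℂ K _ v
          (Summit.AtomisticToContinuum.FouriersLaw.Theorems.MourreDissolution.expI
            (c • (1 : K →L[ℂ] K) + U.smear k) τ v) =
        MeasureTheory.integral
          (Summit.AtomisticToContinuum.FouriersLaw.Theorems.MourreDissolution.specMeasure U v)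
          fun ξ : ℝ => Complex.exp ((τ : ℂ) * Complex.I *
            (c + Summit.AtomisticToContinuum.FouriersLaw.Theorems.MourreDissolution.kernelSymbol k ξ)) := by
  intro K _ _ _ U c k hk τ v
  exact SymbolDatum.inner_expI_op_eq ⟨c, k, hk⟩ U τ v

end Summit.AtomisticToContinuum.FouriersLaw.Theorems.MourreDissolution
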